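import Mathlib
import HarnessLib
import Literature.Analysis.Convex.MonotoneOperatorResolvent
import Literature.Analysis.Convex.KirszbraunValentine

/-!
# Minty's theorem (Eckstein–Bertsekas 1992, Thm 1) and the extension of
# (firmly) nonexpansive operators (Bauschke–Wang 2010)

Literature anchor (statements follow the sources; the proof route is ours, see PROOF ROUTE;
nothing here is new mathematics):

* [EB92] J. Eckstein, D. P. Bertsekas, *On the Douglas–Rachford splitting method and the proximal
  point algorithm for maximal monotone operators*, Math. Programming **55** (1992) 293–318
  (bib key `EcksteinBertsekas1992`; held, `lit` key `paper:doi-10-1007-bf01581204`, p. 296 =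
  PDF p. 4): Theorem 1 (Minty), Theorem 2 (second part), Corollary 2.1.
* [Min62] G. J. Minty, *Monotone (nonlinear) operators in Hilbert space*, Duke Math. J. **29**
  (1962) 341–346 (bib key `Minty1962`) — the original, cited through [EB92] ("originally due to
  Minty [36, 37]") and [Com18].
* [Com18] P. L. Combettes, *Monotone operator theory in convex optimization*, Math. Program.
  **170** (2018) 177–206, arXiv:1802.02694 (bib key `Combettes2018`; held, `lit` key
  `paper:arxiv-1802.02694`, p. 2): Theorem 1.2 (Minty): *Let `A : 𝓗 → 2^𝓗` be a monotone
  operator.  Then `A` is maximally monotone if and only if `ran(Id + A) = 𝓗`.*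
* [BW10] H. H. Bauschke, X. Wang, *Firmly nonexpansive and Kirszbraun–Valentine extensions: a
  constructive approach via monotone operator theory*, Contemp. Math. **513** (2010) 55–64,
  arXiv:0807.1257 (bib key `BauschkeWang2010`; held, `lit` key `paper:arxiv-0807.1257`):
  Fact 1.2 (Kirszbraun–Valentine), Fact 2.5 (`A = F⁻¹ − Id` maximal monotone ⟺ `F` firmly
  nonexpansive with `S = X`), Fact 2.9 (iii) (every monotone `A` has a maximal monotone
  extension `Ã`), Theorem 3.4 (i) (a firmly nonexpansive `F : S → X` has a firmly nonexpansive
  extension `F̃ : X → X`).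
* [GK90] K. Goebel, W. A. Kirk, *Topics in Metric Fixed Point Theory*, Thm 12.4 — used through
  `Literature.Analysis.Convex.KirszbraunValentine` (bib key `GoebelKirk1990`).

THE RESULT [EB92, §2, p. 296].  "The following theorem, originally due to Minty, provides a
crucial characterization of maximal monotone operators: THEOREM 1. *A monotone operator `T` on
`𝓗` is maximal if and only if `im(I + T) = 𝓗`.* … All proofs of the theorem require Zorn's
lemma, or, equivalently, the axiom of choice."  THEOREM 2 (second part): *`T` is maximal
monotone if and only if `J_{cT} = (I + cT)⁻¹` is firmly nonexpansive and has full domain*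
(`c > 0`).  COROLLARY 2.1: *`K` is firmly nonexpansive with full domain if and only if
`K⁻¹ − I` is maximal monotone.*

## What is formalised (namespace `Literature.Analysis.Convex.MonotoneOperator`, extending
`Literature.Analysis.Convex.MonotoneOperatorResolvent`, whose elementary direction
`isMaximalMonotone_of_forall_exists` is completed here; `H` a real Hilbert space)

* EXTENSION OF OPERATORS (operators are subsets of `H × H` as in [EB92, §2]):
  `IsNonexpansive.exists_insert` (one-point extension `C ∪ {(z, v)}`, [GK90, proof of 12.4]),
  `IsFirmlyNonexpansive.exists_insert` (the same for firmly nonexpansive `J`, through `2J − I`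
  and [EB92, Lemma 1 (ii)]), `IsNonexpansive.exists_graph_superset` (Kirszbraun–Valentine in
  operator form: `C ⊆ graph g`, `graph g` nonexpansive — [GK90, Thm 12.4] = [BW10, Fact 1.2]),
  `IsFirmlyNonexpansive.exists_graph_superset` ([BW10, Thm 3.4 (i)], existence only:
  `J ⊆ graph g` with `graph g` firmly nonexpansive, `g = ½(r + I)` for a Kirszbraun–Valentine
  extension `r` of `2J − I`, [BW10, Fact 2.2]).
* MINTY'S THEOREM: `IsMaximalMonotone.forall_exists` (the hard direction: maximal monotone ⇒
  every `z` is `x + cy` with `(x, y) ∈ T`, for every `c > 0`),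
  `IsMaximalMonotone.hasFullDomain_resolvent`, `IsMaximalMonotone.exists_isResolventMap`
  (a resolvent map `j`, `IsResolventMap c T j`, exists — this discharges the standing hypothesis
  under which the companion anchors state [EB92, Thm 3] and [EB92, §4] for "maximal monotone
  `T`"), `isMaximalMonotone_iff_im_eq_univ` ([EB92, Thm 1] literally: `im (I + T) = univ`, via
  `mem_im_opSum_idOp_iff`), `isMaximalMonotone_iff_hasFullDomain_resolvent` ([EB92, Thm 2,
  second part]), `hasFullDomain_of_isMaximalMonotone_invSubId` and
  `isMaximalMonotone_invSubId_iff` ([EB92, Cor 2.1] as an equivalence, = [BW10, Fact 2.5]),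
  and `IsMonotone.exists_isMaximalMonotone_superset` (every monotone operator has a maximal
  monotone extension, [BW10, Fact 2.9 (iii)] — existence only; the source's `Ã` is an explicit
  construction through the Fitzpatrick function and the proximal average, not formalised).

PROOF ROUTE (ours; the statements are the sources').  [BW10] derive the Kirszbraun–Valentine
theorem from maximal monotone extensions; [EB92]/[Min62] prove Theorem 1 directly.  Here the
order is reversed: the Kirszbraun–Valentine intersection lemma [GK90, Lemma 12.2]
(`KirszbraunValentine.exists_nonexpansive_insert`) gives the one-point extension of the firmly
nonexpansive resolvent `J_{cT}` (Thm 2, first part, `isMonotone_iff_isFirmlyNonexpansive_resolvent`)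
to `J' = J_{cT} ∪ {(z, w)}`; the operator `T' = {(x, y) | (x + cy, x) ∈ J'}` is monotone and
contains `T`, so `T' = T` by maximality, and `(w, c⁻¹(z − w)) ∈ T' = T` exhibits
`z ∈ im(I + cT)`.  Zorn's lemma is used only inside [GK90, Thm 12.4] (the full extensions
`exists_graph_superset` and the maximal monotone extension), not for Theorem 1 itself, whose
hypothesis already is maximality.  Everything is proved; there are no named facts and no `sorry`.
Not formalised: the constructive content of [BW10] (Fitzpatrick function, proximal average,
Theorems 2.10–3.6 as algorithms) and [EB92, Cor 2.4] (the bijection `T ↦ J_{cT}`) as a separate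
statement.
-/

noncomputable section

open Set
open scoped RealInnerProductSpace
open Literature.Analysis.Convex.KirszbraunValentine

namespace Literature.Analysis.Convex.MonotoneOperator

variable {H : Type*} [NormedAddCommGroup H] [InnerProductSpace ℝ H]
variable {T C J K : Set (H × H)} {c : ℝ} {x y z : H}

/-! ## Bookkeeping -/

omit [InnerProductSpace ℝ H] in
/-- `IsNonexpansive C` in the relation form used in `KirszbraunValentine`. [folklore] -/
private theorem isNonexpansive_iff_forall :
    IsNonexpansive C ↔ ∀ m ∈ C, ∀ m' ∈ C, ‖m.2 - m'.2‖ ≤ ‖m.1 - m'.1‖ := by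
  constructor
  · rintro hC ⟨x, y⟩ hm ⟨x', y'⟩ hm'
    exact hC hm' hm
  · intro h x y hxy x' y' hxy'
    exact h _ hxy' _ hxy

/-- `2·(J ∪ {(z, w)}) − I = (2J − I) ∪ {(z, 2w − z)}`. [folklore] -/
private theorem reflect_insert (z w : H) (J : Set (H × H)) :
    reflect (insert (z, w) J) = insert (z, (2 : ℝ) • w - z) (reflect J) := by
  ext ⟨x, u⟩
  simp only [mem_reflect_iff, mem_insert_iff, Prod.mk.injEq]
  constructor
  · rintro ⟨y, (⟨rfl, rfl⟩ | hy), rfl⟩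
    · exact Or.inl ⟨rfl, rfl⟩
    · exact Or.inr ⟨y, hy, rfl⟩
  · rintro (⟨rfl, rfl⟩ | ⟨y, hy, rfl⟩)
    · exact ⟨w, Or.inl ⟨rfl, rfl⟩, rfl⟩
    · exact ⟨y, Or.inr hy, rfl⟩

omit [InnerProductSpace ℝ H] in
/-- `im(I + T) = {x + y | (x, y) ∈ T}`. [cite: EcksteinBertsekas1992, §2 p. 295] -/
theorem mem_im_opSum_idOp_iff : z ∈ im (opSum idOp T) ↔ ∃ x y, (x, y) ∈ T ∧ x + y = z := by
  simp only [im, opSum, idOp, Set.mem_setOf_eq]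
  constructor
  · rintro ⟨x, a, b, hax, hb, rfl⟩
    exact ⟨x, b, hb, by rw [hax]⟩
  · rintro ⟨x, y, hxy, rfl⟩
    exact ⟨x, x, y, rfl, hxy, rfl⟩

/-! ## Extension of (firmly) nonexpansive operators (Kirszbraun–Valentine in operator form) -/

section Extension

variable [CompleteSpace H]

/-- One-point extension of a nonexpansive operator, the step "a nonexpansive extension of `T`
from `A` to `A ∪ {p}`" of [GK90, proof of Thm 12.4]: for every `z` there is `v` with
`C ∪ {(z, v)}` nonexpansive. [cite: GoebelKirk1990, Thm 12.4 (proof)] -/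
theorem IsNonexpansive.exists_insert (hC : IsNonexpansive C) (z : H) :
    ∃ v, IsNonexpansive (insert (z, v) C) := by
  obtain ⟨v, hv⟩ := exists_nonexpansive_insert (isNonexpansive_iff_forall.1 hC) z
  exact ⟨v, isNonexpansive_iff_forall.2 hv⟩

/-- One-point extension of a firmly nonexpansive operator: for every `z` there is `w` with
`J ∪ {(z, w)}` firmly nonexpansive (extend `2J − I` by one point and average with `I`,
[EB92, Lemma 1 (ii)]); the one-point case of [BW10, Thm 3.4 (i)].
[cite: BauschkeWang2010, Thm 3.4 (i)] -/
theorem IsFirmlyNonexpansive.exists_insert (hJ : IsFirmlyNonexpansive J) (z : H) :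
    ∃ w, IsFirmlyNonexpansive (insert (z, w) J) := by
  obtain ⟨v, hv⟩ := (isFirmlyNonexpansive_iff_isNonexpansive_reflect.1 hJ).exists_insert z
  refine ⟨(1 / 2 : ℝ) • (v + z), isFirmlyNonexpansive_iff_isNonexpansive_reflect.2 ?_⟩
  have e : (2 : ℝ) • ((1 / 2 : ℝ) • (v + z)) - z = v := by
    rw [smul_smul, show (2 : ℝ) * (1 / 2) = 1 by norm_num, one_smul, add_sub_cancel_right]
  rw [reflect_insert, e]
  exact hv

/-- **Kirszbraun–Valentine in operator form** [GK90, Thm 12.4; BW10, Fact 1.2]: a nonexpansive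
operator `C` is contained in the graph of an everywhere-defined nonexpansive map.
[cite: GoebelKirk1990, Thm 12.4] -/
theorem IsNonexpansive.exists_graph_superset (hC : IsNonexpansive C) :
    ∃ g : H → H, IsNonexpansive (graph g) ∧ C ⊆ graph g := by
  classical
  -- `C` is single-valued, i.e. the graph of a function on `dom C`
  let f : H → H := fun x => if h : ∃ y, (x, y) ∈ C then h.choose else 0
  have hf : ∀ {x y}, (x, y) ∈ C → f x = y := by
    intro x y hxy
    have h : ∃ y, (x, y) ∈ C := ⟨y, hxy⟩
    simp only [f, dif_pos h]
    exact hC.isSingleValued h.choose_spec hxy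
  have hlip : LipschitzOnWith 1 f (dom C) := by
    refine LipschitzOnWith.mk_one fun x hx x' hx' => ?_
    obtain ⟨y, hxy⟩ : ∃ y, (x, y) ∈ C := hx
    obtain ⟨y', hxy'⟩ : ∃ y', (x', y') ∈ C := hx'
    rw [dist_eq_norm, dist_eq_norm, hf hxy, hf hxy']
    exact hC hxy' hxy
  obtain ⟨g, hg, hfg⟩ := exists_lipschitzWith_one_extension hlip
  refine ⟨g, ?_, ?_⟩
  · intro x y hxy x' y' hxy'
    rw [mem_graph_iff] at hxy hxy'
    rw [hxy, hxy', ← dist_eq_norm, ← dist_eq_norm]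
    have h1 := hg.dist_le_mul x' x
    rwa [NNReal.coe_one, one_mul] at h1
  · rintro ⟨x, y⟩ hxy
    have hx : x ∈ dom C := ⟨y, hxy⟩
    rw [mem_graph_iff, ← hfg hx, hf hxy]

/-- **Firmly nonexpansive extension** [BW10, Thm 3.4 (i)] (existence only; the source's
construction via the proximal average is not formalised): a firmly nonexpansive operator `J` is
contained in the graph of an everywhere-defined firmly nonexpansive map (`½(r + I)` for a
Kirszbraun–Valentine extension `r` of `2J − I`). [cite: BauschkeWang2010, Thm 3.4 (i)] -/
theorem IsFirmlyNonexpansive.exists_graph_superset (hJ : IsFirmlyNonexpansive J) :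
    ∃ g : H → H, IsFirmlyNonexpansive (graph g) ∧ J ⊆ graph g := by
  obtain ⟨r, hr, hJr⟩ :=
    (isFirmlyNonexpansive_iff_isNonexpansive_reflect.1 hJ).exists_graph_superset
  have e : graph (fun x => (1 / 2 : ℝ) • (r x + x)) = halfAvgId (graph r) := by
    ext ⟨x, u⟩
    simp only [mem_graph_iff, mem_halfAvgId_iff]
    constructor
    · rintro rfl
      exact ⟨r x, rfl, rfl⟩
    · rintro ⟨y, rfl, rfl⟩
      rfl
  refine ⟨fun x => (1 / 2 : ℝ) • (r x + x),
    isFirmlyNonexpansive_iff_exists_halfAvgId.2 ⟨graph r, hr, e⟩, ?_⟩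
  rintro ⟨x, y⟩ hxy
  have h1 : (x, (2 : ℝ) • y - x) ∈ graph r := hJr (mem_reflect_iff.2 ⟨y, hxy, rfl⟩)
  rw [mem_graph_iff] at h1 ⊢
  rw [← h1, sub_add_cancel, smul_smul, show (1 / 2 : ℝ) * 2 = 1 by norm_num, one_smul]

/-! ## Minty's theorem -/

/-- **Minty's theorem, the hard direction** [EB92, Thm 1 (⇒) and Thm 2, second part;
Minty 1962; Combettes 2018, Thm 1.2]: if `T` is maximal monotone then `im(I + cT) = 𝓗` for
every `c > 0`, i.e. every `z` is `x + cy` with `(x, y) ∈ T`.  Proof: `J_{cT}` is firmly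
nonexpansive (Thm 2); extend it by the one point `z` (`IsFirmlyNonexpansive.exists_insert`,
which rests on the Kirszbraun–Valentine lemma); the operator `T' = {(x, y) | (x + cy, x) ∈ J'}`
is monotone and contains `T`, hence equals `T` by maximality, and `(w, c⁻¹(z − w)) ∈ T'`.
[cite: EcksteinBertsekas1992, §2 Thm 1] -/
theorem IsMaximalMonotone.forall_exists (hT : IsMaximalMonotone T) (hc : 0 < c) (z : H) :
    ∃ x y, (x, y) ∈ T ∧ x + c • y = z := by
  have hJ : IsFirmlyNonexpansive (resolvent c T) :=
    (isMonotone_iff_isFirmlyNonexpansive_resolvent hc).1 hT.1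
  obtain ⟨w, hJ'⟩ := hJ.exists_insert z
  -- the operator whose `c`-resolvent is `J' = J_{cT} ∪ {(z, w)}`
  let T' : Set (H × H) := {p | (p.1 + c • p.2, p.1) ∈ insert (z, w) (resolvent c T)}
  have hsub : T ⊆ T' := by
    rintro ⟨x, y⟩ hxy
    exact mem_insert_of_mem _ (mem_resolvent_of_mem c hxy)
  have hmono : IsMonotone T' := by
    intro x y hxy x' y' hxy'
    have h := hJ' hxy hxy'
    have e : x' + c • y' - (x + c • y) = (x' - x) + c • (y' - y) := by
      rw [smul_sub]; abel
    rw [e, inner_add_left, real_inner_smul_left, real_inner_self_eq_norm_sq,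
      real_inner_comm] at h
    nlinarith [h]
  have hT' : T' ⊆ T := hT.2 hmono hsub
  refine ⟨w, c⁻¹ • (z - w), hT' ?_, ?_⟩
  · show (w + c • c⁻¹ • (z - w), w) ∈ insert (z, w) (resolvent c T)
    rw [smul_smul, mul_inv_cancel₀ hc.ne', one_smul, add_sub_cancel]
    exact mem_insert _ _
  · rw [smul_smul, mul_inv_cancel₀ hc.ne', one_smul, add_sub_cancel]

/-- Maximal monotone ⇒ the resolvent `J_{cT}` (`c > 0`) has full domain.
[cite: EcksteinBertsekas1992, §2 Thm 2] -/
theorem IsMaximalMonotone.hasFullDomain_resolvent (hT : IsMaximalMonotone T) (hc : 0 < c) :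
    HasFullDomain (resolvent c T) := by
  intro z
  obtain ⟨x, y, hxy, e⟩ := hT.forall_exists hc z
  exact ⟨x, y, hxy, e⟩

/-- Maximal monotone ⇒ a resolvent MAP `j` (`(z, j z) ∈ J_{cT}` for all `z`) exists for every
`c > 0`; this discharges the hypothesis `IsResolventMap c T j` under which the companion files
state [EB92, Thm 3] and [EB92, §4]. [cite: EcksteinBertsekas1992, §2 Thm 2] -/
theorem IsMaximalMonotone.exists_isResolventMap (hT : IsMaximalMonotone T) (hc : 0 < c) :
    ∃ j : H → H, IsResolventMap c T j :=
  MonotoneOperator.exists_isResolventMap (hT.forall_exists hc)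

/-- **Minty's theorem** [EB92, Thm 1]: *a monotone operator `T` on `𝓗` is maximal if and only
if `im(I + T) = 𝓗`.* [cite: EcksteinBertsekas1992, §2 Thm 1] -/
theorem isMaximalMonotone_iff_im_eq_univ (hT : IsMonotone T) :
    IsMaximalMonotone T ↔ im (opSum idOp T) = univ := by
  constructor
  · intro h
    refine eq_univ_of_forall fun z => mem_im_opSum_idOp_iff.2 ?_
    obtain ⟨x, y, hxy, e⟩ := h.forall_exists one_pos z
    exact ⟨x, y, hxy, by rwa [one_smul] at e⟩
  · intro h
    refine isMaximalMonotone_of_forall_exists hT one_pos fun z => ?_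
    obtain ⟨x, y, hxy, e⟩ := mem_im_opSum_idOp_iff.1 (h ▸ mem_univ z)
    exact ⟨x, y, hxy, by rwa [one_smul]⟩

/-- **[EB92, Thm 2, second part]**: a monotone `T` is maximal if and only if `J_{cT}` has full
domain (`c > 0`). [cite: EcksteinBertsekas1992, §2 Thm 2] -/
theorem isMaximalMonotone_iff_hasFullDomain_resolvent (hT : IsMonotone T) (hc : 0 < c) :
    IsMaximalMonotone T ↔ HasFullDomain (resolvent c T) :=
  ⟨fun h => h.hasFullDomain_resolvent hc, fun h =>
    isMaximalMonotone_of_forall_exists hT hc fun z => by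
      obtain ⟨x, y, hxy, e⟩ := h z
      exact ⟨x, y, hxy, e⟩⟩

/-- **[EB92, Cor 2.1] (⇒)**, completing `isMaximalMonotone_invSubId`: if `K⁻¹ − I` is maximal
monotone then `K` (`= J_{K⁻¹ − I}`) is firmly nonexpansive with full domain.
[cite: EcksteinBertsekas1992, §2 Cor 2.1] -/
theorem hasFullDomain_of_isMaximalMonotone_invSubId (h : IsMaximalMonotone (invSubId K)) :
    IsFirmlyNonexpansive K ∧ HasFullDomain K := by
  refine ⟨isFirmlyNonexpansive_iff_isMonotone_invSubId.2 h.1, ?_⟩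
  have h1 := h.hasFullDomain_resolvent one_pos
  rwa [resolvent_one_invSubId] at h1

/-- **[EB92, Cor 2.1]** as an equivalence: `K` is firmly nonexpansive with full domain iff
`K⁻¹ − I` is maximal monotone ([BW10, Fact 2.5 (ii)]). [cite: EcksteinBertsekas1992, §2 Cor 2.1] -/
theorem isMaximalMonotone_invSubId_iff :
    IsMaximalMonotone (invSubId K) ↔ IsFirmlyNonexpansive K ∧ HasFullDomain K :=
  ⟨hasFullDomain_of_isMaximalMonotone_invSubId, fun h => isMaximalMonotone_invSubId h.1 h.2⟩

/-- **Maximal monotone extension**: every monotone operator is contained in a maximal monotone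
one (here without Zorn: extend the firmly nonexpansive `J_{1·T}` to a full-domain firmly
nonexpansive graph `K ⊇ J_T` and take `K⁻¹ − I`; the source's `Ã` is an explicit construction via the
Fitzpatrick function, not formalised). [cite: BauschkeWang2010, Fact 2.9 (iii)] -/
theorem IsMonotone.exists_isMaximalMonotone_superset (hT : IsMonotone T) :
    ∃ T' : Set (H × H), IsMaximalMonotone T' ∧ T ⊆ T' := by
  obtain ⟨g, hg, hJg⟩ :=
    ((isMonotone_iff_isFirmlyNonexpansive_resolvent one_pos).1 hT).exists_graph_superset
  refine ⟨invSubId (graph g), isMaximalMonotone_invSubId hg (hasFullDomain_graph g), ?_⟩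
  rintro ⟨x, y⟩ hxy
  have h1 : (x + (1 : ℝ) • y, x) ∈ graph g := hJg (mem_resolvent_of_mem 1 hxy)
  rw [one_smul] at h1
  exact mem_invSubId_iff.2 ⟨x + y, h1, by rw [add_sub_cancel_left]⟩

end Extension

end Literature.Analysis.Convex.MonotoneOperator

end
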